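import Literature.Probability.LatticeModels.AnnealedDeviceCorr
import Literature.Probability.LatticeModels.PoissonDelaunayIsing
import Literature.Probability.LatticeModels.GKSInequalities
import HarnessLib

/-!
# The annealed device correlator: set-correlation form and GKS positivity

Topic `Probability/LatticeModels`; theorem-only companion of `AnnealedDeviceCorr.lean` (the annealed
Ising correlator `annealedDeviceCorr P β` of the S³ Poisson–Delaunay device of route
`CriticalPhenomena/Ising3DConformalLimit/ConformalPoissonDevice`, crux `DeviceWeylUniversality`,
stmt-CriticalPhenomena-4722; recorded by the W_even stub-worker of the line lead, 2026-08-17).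

* `deviceGibbsAverage_eq_isingCorr` — on a finite non-empty configuration the quenched device Gibbs
  average is a SET correlation `⟨σ_B⟩^∅_{univ;β,0}` of the free zero-field state on the pencil-rule
  graph (`B` = chordal read-out sites hit an odd number of times, `monomialSupport`), so the tree's
  finite-volume correlation inequalities apply to the device integrand verbatim;
* `deviceGibbsAverage_nonneg`, `annealedDeviceCorr_nonneg` — GKS I: at ferromagnetic coupling `β ≥ 0`
  the device correlators are non-negative (no measurability needed: `integral_nonneg`).

No definitions, no named facts.
-/

noncomputable section

open scoped Classical
open MeasureTheory Filter Topology
open Literature.Analysis.FunctionSpaces Literature.Probability.LatticeModels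

namespace Literature.Probability.LatticeModels

variable {d : ℕ}

/-- **The device integrand is a set correlation.** For a finite non-empty configuration `ω`, the
quenched Gibbs average of the device read at `x₁, …, xₙ` equals the free zero-field finite-volume
correlation `⟨σ_B⟩^∅_{univ;β,0}` on the pencil-rule graph of `ω`, where `B = monomialSupport w` is the
set of chordal read-out sites `wᵢ = chordalNearest ω xᵢ` hit an odd number of times
(`deviceObservable_eq_prod` + `spinMonomial_eq_spinProduct_monomialSupport`; Friedli–Velenik 2017,
§3.6.1, notation `σ_A`). [cite: FriedliVelenik2017, §3.6.1] -/
theorem deviceGibbsAverage_eq_isingCorr {ω : PointConfig (EuclideanSpace ℝ (Fin d))}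
    (h : (ω : Set (EuclideanSpace ℝ (Fin d))).Finite)
    (hne : (ω : Set (EuclideanSpace ℝ (Fin d))).Nonempty) (β : ℝ) (n : ℕ)
    (x : Fin n → EuclideanSpace ℝ (Fin d)) :
    deviceGibbsAverage β n x ω =
      isingCorr (devicePencilGraph (ω : Set (EuclideanSpace ℝ (Fin d))) h) Finset.univ β 0
        BoundaryCondition.free
        (monomialSupport fun i => (⟨chordalNearest (ω : Set (EuclideanSpace ℝ (Fin d))) (x i),
          h.mem_toFinset.2 (chordalNearest_mem h hne (x i))⟩ : ↥h.toFinset)) := by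
  rw [deviceGibbsAverage, dif_pos h, isingCorr]
  congr 1
  funext σ
  rw [deviceObservable_eq_prod h hne, ← spinMonomial_eq_spinProduct_monomialSupport]
  rfl

/-- **GKS I for the device integrand**: at ferromagnetic coupling `β ≥ 0` the quenched device Gibbs
average is non-negative — a free zero-field set correlation on a finite graph (Griffiths 1967 /
Kelly–Sherman 1968, tree `GKSInequalities.gks_one_holds`), the value `1` on the empty configuration
and the junk `0` on infinite ones. [cite: KellySherman1968] -/
theorem deviceGibbsAverage_nonneg {β : ℝ} (hβ : 0 ≤ β) (n : ℕ) (x : Fin n → EuclideanSpace ℝ (Fin d))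
    (ω : PointConfig (EuclideanSpace ℝ (Fin d))) : 0 ≤ deviceGibbsAverage β n x ω := by
  by_cases h : (ω : Set (EuclideanSpace ℝ (Fin d))).Finite
  · by_cases hne : (ω : Set (EuclideanSpace ℝ (Fin d))).Nonempty
    · rw [deviceGibbsAverage_eq_isingCorr h hne]
      exact GKSInequalities.gks_one_holds _ hβ le_rfl (Or.inl rfl) (Finset.subset_univ _)
    · rw [deviceGibbsAverage_of_eq_empty β n x (Set.not_nonempty_iff_eq_empty.1 hne)]
      exact zero_le_one
  · rw [deviceGibbsAverage, dif_neg h]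

/-- **The annealed device correlators are non-negative** for `β ≥ 0` and any law `P` (GKS I
pointwise in `ω`, `integral_nonneg`; no measurability of the integrand is needed).
[cite: KellySherman1968] -/
theorem annealedDeviceCorr_nonneg (P : Measure (PointConfig (EuclideanSpace ℝ (Fin d)))) {β : ℝ}
    (hβ : 0 ≤ β) (n : ℕ) (x : Fin n → EuclideanSpace ℝ (Fin d)) :
    0 ≤ annealedDeviceCorr P β n x := by
  rw [annealedDeviceCorr_eq_integral]
  exact integral_nonneg fun ω => deviceGibbsAverage_nonneg hβ n x ω

end Literature.Probability.LatticeModels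

end
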